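import Literature.AnabelianGeometry.AbsoluteAnabelian.AutHolomorphicSpacesConjChartProofs
import Literature.Analysis.Complex.UnitDiscRCAutomorphisms
import HarnessLib

/-!
# [AbsTopIII] Prop. 2.2 (i) DISCHARGED: isomorphisms of Aut-holomorphic discs are RC-holomorphic

PROOF-ONLY companion of `AutHolomorphicSpaces` (owner module, abc-iut L4-t2): kernel proof of the
named `Prop` fact `DiscAutHolIsoIsRCHolomorphic` — S. Mochizuki, *Topics in absolute anabelian
geometry III*, Prop. 2.2 (i) p.52: for Aut-holomorphic discs `𝕏`, `𝕐` arising from Riemann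
surfaces `X`, `Y`, "every isomorphism of Aut-holomorphic spaces `𝕏 ≅ 𝕐` arises from a unique
RC-holomorphic isomorphism `X ≅ Y`" (as typed: a homeomorphism `φ : X ≃ₜ Y` that is a morphism of
the associated Aut-holomorphic spaces in both directions is RC-holomorphic together with its
inverse).

Route (replacing the printed appeal to Cartan's theorem on `SL₂(ℝ)/{±1}`, p.53): transport `φ`
along biholomorphisms `X ≅ 𝔻 ≅ Y` to a homeomorphism `h` of the unit disc; the morphism property
on the connected open `⊤` says that `h` normalises `Aut(𝔻)`; by
`Literature.Analysis.Complex.exists_eq_discRot_or_conj_of_normalizes` (elementary hyperbolic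
geometry: half-turn equivariance, two-point homogeneity, the affine comparison on circles and the
doubling identity) `h` is a Möbius map or an anti-Möbius map, whence `φ` is holomorphic or
anti-holomorphic in the charts of `X`, `Y`.  The two transport statements
(`isDiscAut_conj_of_transport` here, `differentiableAt_conj_writtenInExtChartAt_of_eventually` in
`AutHolomorphicSpacesConjChartProofs`) are stated for arbitrary biholomorphic disc parametrisations
so that the localisation to chart discs (Cor. 2.3) can reuse them.

HONEST FRAMING: our kernel check of a classical statement of a refereed paper; nothing here bears
on [IUTchIII] Cor. 3.12.  Bib key `MochizukiAbsTopIII2015`; locators = kurims manuscript pages.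
-/

noncomputable section

namespace Literature.AnabelianGeometry.AbsoluteAnabelian

open _root_.TopologicalSpace _root_.Topology _root_.Set _root_.Metric _root_.Function _root_.Filter
open scoped _root_.Manifold _root_.ContDiff ComplexConjugate
open Literature.Analysis.Complex

/-! ### Transport: conjugation by a biholomorphically parametrised homeomorphism -/

section Transport

variable {P Q : Type*} [TopologicalSpace P] [ChartedSpace ℂ P] [TopologicalSpace Q] [ChartedSpace ℂ Q]

/-- **Conjugating `Aut(𝔻)` through a homeomorphism of disc-like Riemann surfaces.**  Let
`e_P : P ≅ 𝔻`, `e_Q : Q ≅ 𝔻` be biholomorphic homeomorphisms onto `unitDiscOpens` and `e : P ≃ₜ Q` a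
homeomorphism such that `e ψ e⁻¹` is biholomorphic for every biholomorphic self-homeomorphism `ψ` of
`P`.  Then the disc homeomorphism `h = e_Q ∘ e ∘ e_P⁻¹` (total function, inverse
`k = e_P ∘ e⁻¹ ∘ e_Q⁻¹`) conjugates holomorphic automorphisms of the disc to holomorphic
automorphisms. [cite: MochizukiAbsTopIII2015, Proposition 2.2 (i) p.52] -/
theorem isDiscAut_conj_of_transport (eP : P ≃ₜ unitDiscOpens)
    (heP : MDifferentiable 𝓘(ℂ, ℂ) 𝓘(ℂ, ℂ) eP) (hePs : MDifferentiable 𝓘(ℂ, ℂ) 𝓘(ℂ, ℂ) eP.symm)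
    (eQ : Q ≃ₜ unitDiscOpens) (heQ : MDifferentiable 𝓘(ℂ, ℂ) 𝓘(ℂ, ℂ) eQ)
    (heQs : MDifferentiable 𝓘(ℂ, ℂ) 𝓘(ℂ, ℂ) eQ.symm) (e : P ≃ₜ Q)
    (hconj : ∀ ψ : P ≃ₜ P, MDifferentiable 𝓘(ℂ, ℂ) 𝓘(ℂ, ℂ) ψ →
      MDifferentiable 𝓘(ℂ, ℂ) 𝓘(ℂ, ℂ) ψ.symm →
      MDifferentiable 𝓘(ℂ, ℂ) 𝓘(ℂ, ℂ) (e.symm.trans (ψ.trans e)) ∧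
        MDifferentiable 𝓘(ℂ, ℂ) 𝓘(ℂ, ℂ) (e.symm.trans (ψ.symm.trans e)))
    {f : ℂ → ℂ} (hf : IsDiscAut f) :
    IsDiscAut (Function.extend Subtype.val (Subtype.val ∘ (eP.symm.trans (e.trans eQ)))
        (fun _ => (0 : ℂ)) ∘ f ∘
      Function.extend Subtype.val (Subtype.val ∘ (eQ.symm.trans (e.symm.trans eP))) fun _ => 0) := by
  set H := eP.symm.trans (e.trans eQ) with hH
  set K := eQ.symm.trans (e.symm.trans eP) with hK
  set h : ℂ → ℂ := Function.extend Subtype.val (Subtype.val ∘ H) fun _ => 0 with hh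
  set k : ℂ → ℂ := Function.extend Subtype.val (Subtype.val ∘ K) fun _ => 0 with hk
  -- the automorphism as a biholomorphic homeomorphism `T` of the disc, transported to `P`
  obtain ⟨T, g, hg, hTf, hTg, hgf, hfg, hTd, hTsd⟩ := exists_homeomorph_unitDiscOpens_of_isDiscAut hf
  set F : P ≃ₜ P := eP.trans (T.trans eP.symm) with hF
  have hFd : MDifferentiable 𝓘(ℂ, ℂ) 𝓘(ℂ, ℂ) F := hePs.comp (hTd.comp heP)
  have hFsd : MDifferentiable 𝓘(ℂ, ℂ) 𝓘(ℂ, ℂ) F.symm := hePs.comp (hTsd.comp heP)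
  obtain ⟨hGd, hGsd⟩ := hconj F hFd hFsd
  set S : unitDiscOpens → unitDiscOpens := eQ ∘ (e.symm.trans (F.trans e)) ∘ eQ.symm with hS
  set S' : unitDiscOpens → unitDiscOpens := eQ ∘ (e.symm.trans (F.symm.trans e)) ∘ eQ.symm with hS'
  have hSd : MDifferentiable 𝓘(ℂ, ℂ) 𝓘(ℂ, ℂ) S := heQ.comp (hGd.comp heQs)
  have hS'd : MDifferentiable 𝓘(ℂ, ℂ) 𝓘(ℂ, ℂ) S' := heQ.comp (hGsd.comp heQs)
  -- identify the total extensions with `h ∘ f ∘ k` and `h ∘ g ∘ k`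
  have hk_apply : ∀ {z : ℂ} (hz : z ∈ ball (0 : ℂ) 1), k z = (eP (e.symm (eQ.symm ⟨z, hz⟩)) : ℂ) :=
    fun hz => extend_apply_of_mem _ _ hz
  have hh_apply : ∀ x : unitDiscOpens, h x = (eQ (e (eP.symm x)) : ℂ) :=
    fun x => extend_apply_coe _ _ x
  have e1 : EqOn (Function.extend Subtype.val (Subtype.val ∘ S) fun _ => 0) (h ∘ f ∘ k) (ball 0 1) := by
    intro z hz
    rw [extend_apply_of_mem _ _ hz]
    simp only [comp_apply, hk_apply hz]
    rw [← hTf, hh_apply]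
    simp [hS, hF]
  have e2 : EqOn (Function.extend Subtype.val (Subtype.val ∘ S') fun _ => 0) (h ∘ g ∘ k) (ball 0 1) := by
    intro z hz
    rw [extend_apply_of_mem _ _ hz]
    simp only [comp_apply, hk_apply hz]
    rw [← hTg, hh_apply]
    simp [hS', hF]
  have hkh : ∀ z ∈ ball (0 : ℂ) 1, k (h z) = z := by
    intro z hz
    rw [show h z = h (⟨z, hz⟩ : unitDiscOpens) from rfl, hh_apply,
      hk_apply (eQ (e (eP.symm ⟨z, hz⟩))).2]
    simp
  refine IsDiscAut.mk' ((differentiableOn_extend_of_mdifferentiable hSd).congr fun z hz => (e1 hz).symm)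
    (((mapsTo_extend H).comp hf.mapsTo).comp (mapsTo_extend K))
    ((differentiableOn_extend_of_mdifferentiable hS'd).congr fun z hz => (e2 hz).symm)
    (((mapsTo_extend H).comp hg.mapsTo).comp (mapsTo_extend K)) (fun z hz => ?_) fun z hz => ?_
  · simp only [comp_apply]
    rw [hkh _ (hf.mapsTo (mapsTo_extend K hz)), hgf _ (mapsTo_extend K hz)]
    show h (k z) = z
    rw [hk_apply hz, hh_apply]
    simp
  · simp only [comp_apply]
    rw [hkh _ (hg.mapsTo (mapsTo_extend K hz)), hfg _ (mapsTo_extend K hz)]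
    show h (k z) = z
    rw [hk_apply hz, hh_apply]
    simp

/-- Under the hypotheses of `isDiscAut_conj_of_transport`, the disc picture `h = e_Q ∘ e ∘ e_P⁻¹` of
`e` is a Möbius map `z ↦ c·φ_a(z)` or an anti-Möbius map `z ↦ c·φ_a(z̄)` on the disc (the tree's
`exists_eq_discRot_or_conj_of_normalizes`). [cite: MochizukiAbsTopIII2015, Proposition 2.2 (i) p.52] -/
theorem exists_discRot_of_transport (eP : P ≃ₜ unitDiscOpens)
    (heP : MDifferentiable 𝓘(ℂ, ℂ) 𝓘(ℂ, ℂ) eP) (hePs : MDifferentiable 𝓘(ℂ, ℂ) 𝓘(ℂ, ℂ) eP.symm)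
    (eQ : Q ≃ₜ unitDiscOpens) (heQ : MDifferentiable 𝓘(ℂ, ℂ) 𝓘(ℂ, ℂ) eQ)
    (heQs : MDifferentiable 𝓘(ℂ, ℂ) 𝓘(ℂ, ℂ) eQ.symm) (e : P ≃ₜ Q)
    (hconj : ∀ ψ : P ≃ₜ P, MDifferentiable 𝓘(ℂ, ℂ) 𝓘(ℂ, ℂ) ψ →
      MDifferentiable 𝓘(ℂ, ℂ) 𝓘(ℂ, ℂ) ψ.symm →
      MDifferentiable 𝓘(ℂ, ℂ) 𝓘(ℂ, ℂ) (e.symm.trans (ψ.trans e)) ∧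
        MDifferentiable 𝓘(ℂ, ℂ) 𝓘(ℂ, ℂ) (e.symm.trans (ψ.symm.trans e))) :
    ∃ c a : ℂ, ‖c‖ = 1 ∧ ‖a‖ < 1 ∧
      ((∀ x : unitDiscOpens, ((eP.symm.trans (e.trans eQ)) x : ℂ) = discRot c a x) ∨
        ∀ x : unitDiscOpens, ((eP.symm.trans (e.trans eQ)) x : ℂ) = discRot c a (conj (x : ℂ))) := by
  set H := eP.symm.trans (e.trans eQ) with hH
  set K := eQ.symm.trans (e.symm.trans eP) with hK
  set h : ℂ → ℂ := Function.extend Subtype.val (Subtype.val ∘ H) fun _ => 0 with hh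
  set k : ℂ → ℂ := Function.extend Subtype.val (Subtype.val ∘ K) fun _ => 0 with hk
  have hnorm : ∀ f, IsDiscAut f → IsDiscAut (h ∘ f ∘ k) := fun f hf =>
    isDiscAut_conj_of_transport eP heP hePs eQ heQ heQs e hconj hf
  have hhc : ContinuousOn h (ball 0 1) := continuousOn_extend H.continuous
  have hhm : MapsTo h (ball 0 1) (ball 0 1) := mapsTo_extend H
  have hkm : MapsTo k (ball 0 1) (ball 0 1) := mapsTo_extend K
  have hh_apply : ∀ x : unitDiscOpens, h x = (H x : ℂ) := fun x => extend_apply_coe _ _ x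
  have hk_apply : ∀ x : unitDiscOpens, k x = (K x : ℂ) := fun x => extend_apply_coe _ _ x
  have hkh : ∀ z ∈ ball (0 : ℂ) 1, k (h z) = z := by
    intro z hz
    rw [show h z = h (⟨z, hz⟩ : unitDiscOpens) from rfl, hh_apply, hk_apply]
    simp [hH, hK]
  have hhk : ∀ z ∈ ball (0 : ℂ) 1, h (k z) = z := by
    intro z hz
    rw [show k z = k (⟨z, hz⟩ : unitDiscOpens) from rfl, hk_apply, hh_apply]
    simp [hH, hK]
  obtain ⟨c, a, hc, ha, hcase⟩ := exists_eq_discRot_or_conj_of_normalizes hhc hhm hkm hkh hhk hnorm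
  refine ⟨c, a, hc, ha, ?_⟩
  rcases hcase with hhol | hanti
  · exact Or.inl fun x => by rw [← hh_apply, hhol x.2]
  · exact Or.inr fun x => by rw [← hh_apply, hanti x.2]

end Transport

/-! ### Proposition 2.2 (i) -/

section Disc

variable {X Y : Type} [TopologicalSpace X] [ChartedSpace ℂ X] [IsManifold 𝓘(ℂ, ℂ) ω X]
  [TopologicalSpace Y] [ChartedSpace ℂ Y] [IsManifold 𝓘(ℂ, ℂ) ω Y]

omit [IsManifold 𝓘(ℂ, ℂ) ω X] [IsManifold 𝓘(ℂ, ℂ) ω Y] in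
/-- A morphism of the Aut-holomorphic spaces of two Aut-holomorphic discs conjugates biholomorphic
self-homeomorphisms of `X` to biholomorphic self-homeomorphisms of `Y` (the morphism property on
the connected open `⊤`). [cite: MochizukiAbsTopIII2015, Proposition 2.2 (i) p.52] -/
theorem mdifferentiable_conj_of_isMorphism (hX : IsAutHolDisc X) (hY : IsAutHolDisc Y) (φ : X ≃ₜ Y)
    (hφ : IsMorphism (AutHolStructure.ofCharted X) (AutHolStructure.ofCharted Y) φ)
    (ψ : X ≃ₜ X) (hψ : MDifferentiable 𝓘(ℂ, ℂ) 𝓘(ℂ, ℂ) ψ)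
    (hψs : MDifferentiable 𝓘(ℂ, ℂ) 𝓘(ℂ, ℂ) ψ.symm) :
    MDifferentiable 𝓘(ℂ, ℂ) 𝓘(ℂ, ℂ) (φ.symm.trans (ψ.trans φ)) ∧
      MDifferentiable 𝓘(ℂ, ℂ) 𝓘(ℂ, ℂ) (φ.symm.trans (ψ.symm.trans φ)) := by
  obtain ⟨ψ₀, hψ₀, hψ₀s⟩ := exists_homeomorph_top ψ
  have hmem : ψ₀ ∈ holAut (⊤ : Opens X) := by
    rw [mem_holAut_iff]
    exact ⟨fun x => (mdifferentiableAt_opens_iff (Φ := ψ) hψ₀ x).2 (hψ _),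
      fun x => (mdifferentiableAt_opens_iff (Φ := ψ.symm) hψ₀s x).2 (hψs _)⟩
  obtain ⟨e₀, he₀, he₀s⟩ := exists_homeomorph_top φ
  have hconnX := isConnected_top_of_isAutHolDisc hX
  have hconnY := isConnected_top_of_isAutHolDisc hY
  have hmap := hφ.map_aut_eq ⟨⊤, hconnX⟩ ⟨⊤, hconnY⟩ hconnX hconnY e₀ he₀
  have h' : homeoConj e₀ ψ₀ ∈ holAut (⊤ : Opens Y) := by
    have : homeoConj e₀ ψ₀ ∈ ((AutHolStructure.ofCharted X).aut ⟨⊤, hconnX⟩).map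
        (homeoConj e₀).toMonoidHom := Subgroup.mem_map_of_mem _ hmem
    rwa [hmap] at this
  rw [mem_holAut_iff] at h'
  have hc1 : ∀ y : (⊤ : Opens Y), ((homeoConj e₀ ψ₀) y : Y) = (φ.symm.trans (ψ.trans φ)) y := by
    intro y
    show (e₀ (ψ₀ (e₀.symm y)) : Y) = φ (ψ (φ.symm y))
    rw [he₀, hψ₀, he₀s]
  have hc2 : ∀ y : (⊤ : Opens Y), ((homeoConj e₀ ψ₀).symm y : Y) = (φ.symm.trans (ψ.symm.trans φ)) y := by
    intro y
    show (e₀ (ψ₀.symm (e₀.symm y)) : Y) = φ (ψ.symm (φ.symm y))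
    rw [he₀, hψ₀s, he₀s]
  exact ⟨fun y => (mdifferentiableAt_opens_iff (Ψ := homeoConj e₀ ψ₀) hc1 ⟨y, trivial⟩).1 (h'.1 _),
    fun y => (mdifferentiableAt_opens_iff (Ψ := (homeoConj e₀ ψ₀).symm) hc2 ⟨y, trivial⟩).1 (h'.2 _)⟩

/-- **One direction of Prop. 2.2 (i)**: a homeomorphism of Aut-holomorphic discs that is a morphism
of Aut-holomorphic spaces is RC-holomorphic. [cite: MochizukiAbsTopIII2015, Proposition 2.2 (i) p.52] -/
theorem isRCHolomorphic_of_isMorphism_of_isAutHolDisc (hX : IsAutHolDisc X) (hY : IsAutHolDisc Y)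
    (φ : X ≃ₜ Y) (hφ : IsMorphism (AutHolStructure.ofCharted X) (AutHolStructure.ofCharted Y) φ) :
    IsRCHolomorphic (⇑φ) := by
  obtain ⟨eX, heX, heXs⟩ := hX.exists_biholomorphic
  obtain ⟨eY, heY, heYs⟩ := hY.exists_biholomorphic
  have hconj := mdifferentiable_conj_of_isMorphism hX hY φ hφ
  obtain ⟨c, a, hc, ha, hcase⟩ := exists_discRot_of_transport eX heX heXs eY heY heYs φ hconj
  set H := eX.symm.trans (φ.trans eY) with hH
  have hφH : ∀ x : X, φ x = eY.symm (H (eX x)) := by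
    intro x; simp [hH]
  rcases hcase with hhol | hanti
  · -- holomorphic case: `H` is `ℂ`-differentiable, hence so is `φ = e_Y⁻¹ ∘ H ∘ e_X`
    have hHd : MDifferentiable 𝓘(ℂ, ℂ) 𝓘(ℂ, ℂ) H :=
      mdifferentiable_of_differentiableOn (isDiscAut_discRot hc ha).differentiableOn hhol
    have hφd : MDifferentiable 𝓘(ℂ, ℂ) 𝓘(ℂ, ℂ) (⇑φ) := by
      have : (⇑φ) = eY.symm ∘ H ∘ eX := funext fun x => by simp [hφH]
      rw [this]
      exact heYs.comp (hHd.comp heX)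
    exact fun x => Or.inl (Filter.Eventually.of_forall fun y => hφd y)
  · -- anti-holomorphic case
    have hRm : MapsTo (discRot c a) (ball 0 1) (ball 0 1) := (isDiscAut_discRot hc ha).mapsTo
    have hloc : ∀ x : X, φ x = eY.symm ⟨discRot c a (conj (eX x : ℂ)),
        hRm (conj_mem_unitBall (eX x).2)⟩ := by
      intro x
      rw [hφH]
      congr 1
      exact Subtype.ext (hanti (eX x))
    exact fun x => Or.inr (Filter.Eventually.of_forall fun y =>
      ⟨φ.continuous.continuousAt, differentiableAt_conj_writtenInExtChartAt_of_eventually φ y eX (heX y)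
        eY.symm heYs (isDiscAut_discRot hc ha).differentiableOn hRm
        (Filter.Eventually.of_forall fun p => hloc p)⟩)

end Disc

/-- **[AbsTopIII] Prop. 2.2 (i) holds as typed** (`DiscAutHolIsoIsRCHolomorphic` DISCHARGED): for
Aut-holomorphic discs `X`, `Y`, every homeomorphism `φ : X ≃ₜ Y` which is a morphism of the associated
Aut-holomorphic spaces in both directions is an RC-holomorphic isomorphism — `φ` and `φ⁻¹` are
holomorphic or anti-holomorphic at each point. [cite: MochizukiAbsTopIII2015, Proposition 2.2 (i) p.52] -/
theorem discAutHolIsoIsRCHolomorphic_holds : DiscAutHolIsoIsRCHolomorphic := by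
  intro X Y _ _ _ _ _ _ _ _ hX hY φ hφ hφ'
  exact ⟨isRCHolomorphic_of_isMorphism_of_isAutHolDisc hX hY φ hφ,
    isRCHolomorphic_of_isMorphism_of_isAutHolDisc hY hX φ.symm hφ'⟩

end Literature.AnabelianGeometry.AbsoluteAnabelian
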